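import Summits.MatrixMultiplication.MatrixMultiplication.Theorems.AbelianSTPPCensusTAStatDefs
import Summits.MatrixMultiplication.MatrixMultiplication.Theorems.AbelianSTPPCensusTAStatEData
import Summits.MatrixMultiplication.MatrixMultiplication.Theorems.AbelianSTPPCensusTAGainTable2371Ext10
import Summits.MatrixMultiplication.MatrixMultiplication.Theorems.AbelianSTPPCensusTAStatKMemberX2

/-!
# T_A static certificate, range `6380 … 6779`: theory's t*-indexed linear checker with the k-member bucket-descent tree at `τ = 2371/1000` (definitions)

Cell mm-stpp (rung F-M1), tier T_A = «beat `2.371`, the record exponent (ADVXXZ'25 / DEK+26 rounded)»; successor kernel item of the closed crux item stmt-MatrixMultiplication-19191, seat mm-stpp-vp-p2 (gen 6); fifth T_A range after `AbelianSTPPCensusLeafTA6379Closed.lean` (theory g12, universe `6379`, where the static one- and two-member certificate family ends: first uncovered order `6380`).  This file is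
theory g12's `AbelianSTPPCensusTAStatDDefs.lean` (fourth T_A range; design `AbelianSTPPCensusTAStatDefs.lean`, theory g11) with the range constants and the gain
exchanged — universe `Mtop = 6779`, orders `lo = 6380 … 6779`, table `TAStatEData.E` (50 levels × 75 buckets), gains `ShapeCert.gainOf2371j`
(`AbelianSTPPCensusTAGainTable2371Ext10.lean`), budget parameter of a bucket = its lower end (`tp = tb`) — and ONE structural change: the fallback of a failing one-member
`cover` in the bucket walk is the k-member bucket-descent TREE WITH SEVERAL GRYNKIEWICZ PARAMETERS PER NODE `TAStatKM.coverKX` of `AbelianSTPPCensusTAStatKMemberX.lean` (vp-p2 gen 6; extra entries `xrow`, levels `≥ ix0`, buckets `≥ jx0`) (at most `kmax = 10` explicit members;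
the bucket lists `TAStatEData.M2` are complete for EVERY bucket, checked by `m2V`), i.e. the walk is `TAStatKM.walk5` (`tiOK90` escape, `AbelianSTPPCensusTAStatKMemberX2.lean`).  The data-free parts (`TAStat.tm`, `e0`, `domP`,
`leP`, `leW`, `vpI`, `p1I`, `p2I`, `p3I`, `piece`, `pcs`, `vpCand`, `vpThresh`, `cover`; `TAStat2M.tiOK`; `TAStatKM.testKX/goI/treeKX/rootKX/coverKX/walk4`) are reused by name.
Exact integer twin: seat twin/tastat8.py (run `ta_6779_60_K10_x`, `JOB_K=10`, bucket parameter `TB[j]` plus the extra parameters `[192, 176, 160, 144, 136]` at levels `≥ 36`, buckets `≥ 64`: all 2114101 (shape, bucket) cells of the orders `6380 … 6779` pass,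
141 of them through the tree with 4771340 tree nodes in all; the same tree reaches the wall of the hypothesis set (`6834`: `TALinWall.vmU11GE3CensusTA_false_at_6834`, theory g12) in the twin — `6380 … 6833` ALL PASS at 31.9 M tree nodes (kit j307779) — but from the order `6783` on single (cell, order) trees exceed 10⁵ nodes (`(15,15,18)`, bucket `[220,246]`: 4.4·10⁵ at `6790`, 10⁶ at `6833`), beyond one `decide`; this range stops at `6779` (largest single (cell, order) tree 5.0·10⁴ nodes)).
Soundness: `AbelianSTPPCensusTAStatE{Rows,Rows2,Sound}.lean`; kernel evaluations `…TAStatEDom*/Ck*`; leaf `AbelianSTPPCensusLeafTA6779Closed.lean` (`noAbelianSTPPHostUpTo_2371_6779`).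
WHAT THIS IS NOT: no statement about STPP families or `ω` — arithmetic on shape lists only; nothing about orders `> 6779` or `< 6380`.
-/

set_option linter.dupNamespace false
set_option autoImplicit false

namespace Summit.MatrixMultiplication.MatrixMultiplication.Theorems.TAStatE

open TECert (tableOK vol us)
open ShapeCert (gainOf2371j D)
open TAStatEData (E VL TB M2 M2F XR nl nb)
open TAStat (tm Entry e0 domP leP leW vpI p1I p2I p3I piece pcs vpCand vpThresh cover)

/-! ## Parameters -/

/-- Largest order of the certificate (= the order of the single-member table defining the candidate shapes). -/
def Mtop : ℕ := 6779
/-- Least order of this range (orders `≤ 6379`: `noAbelianSTPPHostUpTo_2371_6379`). -/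
def lo : ℕ := 6380
/-- Number of sub-intervals of orders on which the vM bound is re-checked by endpoint evaluation when one interval does not suffice. -/
def J : ℕ := 12
/-- Largest number of explicit members in a tree node (the maximal member and `kmax − 1` companions). -/
def kmax : ℕ := 10

/-! ## Candidate shapes (sorted), levels and buckets -/

/-- The sorted candidate shapes `(a, b, c)`, `a ≤ b ≤ c`, of volume exactly `V`, passing `TECert.tableOK` at order `Mtop`
(`a ≤ 18`, `b ≤ 82` suffice since `19³ = 6859 > Mtop` and `83² = 6889 > Mtop`). -/
def triplesS (V : ℕ) : List (ℕ × ℕ × ℕ) :=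
  (List.range 18).flatMap fun a' =>
    if V % (a' + 1) = 0 then
      (List.range 82).filterMap fun b' =>
        if a' ≤ b' ∧ V / (a' + 1) % (b' + 1) = 0 ∧ b' + 1 ≤ V / (a' + 1) / (b' + 1) ∧
            tableOK Mtop (a' + 1) (b' + 1) (V / (a' + 1) / (b' + 1)) = true then
          some (a' + 1, b' + 1, V / (a' + 1) / (b' + 1))
        else none
    else []

/-- level of a volume: the first index `i` with `V ≤ VL[i]` (`VL.length` if none). -/
def levOf (V : ℕ) : ℕ := VL.findIdx fun vl => decide (V ≤ vl)

/-- bucket of a parameter `t ≥ 1`: the last index `j` with `TB[j] ≤ t` (computed as (first index with `t < TB[j]`) − 1). -/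
def bucketOf (t : ℕ) : ℕ := (TB.findIdx fun b => decide (t < b)) - 1

/-- lower end `TB[j]` of bucket `j` (default `1000` beyond the list, which keeps `tb` monotone and below `10⁶` everywhere — the form the tree's soundness consumes) -/
def tb (j : ℕ) : ℕ := TB.getD j 1000

/-- budget parameter of bucket `j`: in this range the bucket's own lower end `TB[j]` (the `TP`-clauses of `monoOK` hold trivially) -/
def tp (j : ℕ) : ℕ := tb j

/-- second-member list of bucket `j` (default `[]`) -/
def m2l (j : ℕ) : List (ℕ × ℕ × ℕ) := M2.getD j []

/-- list flag of bucket `j` (default `false`): `M2[j]` is complete for the bucket (here every bucket `< nb`) -/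
def m2f (j : ℕ) : Bool := M2F.getD j false

/-! ## The table entries -/

/-- entry `(i, j)` of the table -/
def ent (i j : ℕ) : Entry := (E.getD i []).getD j e0

/-- the table row of the level of a volume `V`, as a function of the bucket (read by the tree at every bucket it visits) -/
def rowOf (V : ℕ) (j : ℕ) : Entry := (E.getD (levOf V) []).getD j e0

/-- first level carrying extra U11-G parameters -/
def ix0 : ℕ := 36
/-- first bucket carrying extra U11-G parameters -/
def jx0 : ℕ := 64

/-- the extra U11-G entries `(t′, gW′, wW′)` of level `i`, bucket `j` (empty below level `ix0` or bucket `jx0`) -/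
def xrow (i j : ℕ) : List (ℕ × ℕ × ℕ) := if ix0 ≤ i ∧ jx0 ≤ j then (XR.getD (i - ix0) []).getD (j - jx0) [] else []

/-- the extra entries read by the tree for a maximal member of volume `V` (the level of `V`), as a function of the bucket -/
def xrowOf (V : ℕ) (j : ℕ) : List (ℕ × ℕ × ℕ) := xrow (levOf V) j

/-- U11-G domination of a shape (gain `g`, volume `V`, pair-product sum `p`) along a table row from bucket `j` on, each entry read at its own bucket
budget parameter `t = TP[j]`: `V < t·p` and `g·wW ≤ gW·(t·p − V)`. -/
def domWrow (g V p : ℕ) : List Entry → ℕ → Bool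
  | [], _ => true
  | e :: es, j => Nat.blt V (tp j * p) && Nat.ble (g * e.2.2.2) (e.2.2.1 * (tp j * p - V)) && domWrow g V p es (j + 1)

/-- domination of one sorted candidate shape `x` of volume `V` (gain `g`): vM at its own (level, bucket), U11-G at its own level and every bucket
from its own on. -/
def domX (V g : ℕ) (x : ℕ × ℕ × ℕ) : Bool :=
  domP g (us x) ((E.getD (levOf V) []).getD (bucketOf (tm x)) e0) &&
    domWrow g V (us x) ((E.getD (levOf V) []).drop (bucketOf (tm x))) (bucketOf (tm x))

/-- every sorted candidate shape of the volumes `V, …, V + n − 1` is dominated (`domX`) -/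
def domV : ℕ → ℕ → Bool
  | 0, _ => true
  | n + 1, V => (triplesS V).all (domX V (gainOf2371j V)) && domV n (V + 1)

/-- domination of a shape (gain `g`, volume `V`, pair-product sum `p`) at every extra entry `(t′, gW′, wW′)` of a list: `V < t′·p` and
`g·wW′ ≤ gW′·(t′·p − V)`. -/
def domXTrow (g V p : ℕ) (xs : List (ℕ × ℕ × ℕ)) : Bool :=
  xs.all fun e => Nat.blt V (e.1 * p) && Nat.ble (g * e.2.2) (e.2.1 * (e.1 * p - V))

/-- domination of one sorted candidate shape `x` of volume `V` (gain `g`) at the extra entries of level `i`, every bucket `≥ jx0` from that of `tm x` on -/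
def domXT (i V g : ℕ) (x : ℕ × ℕ × ℕ) : Bool :=
  (List.range (nb - jx0)).all fun j' => Nat.blt (jx0 + j') (bucketOf (tm x)) || domXTrow g V (us x) (xrow i (jx0 + j'))

/-- … at the extra entries of EVERY level `≥ ix0` whose volume bound covers `V` -/
def domXTall (V g : ℕ) (x : ℕ × ℕ × ℕ) : Bool :=
  (List.range (nl - ix0)).all fun i' => Nat.blt (VL.getD (ix0 + i') 0) V || domXT (ix0 + i') V g x

/-- every sorted candidate shape of the volumes `V, …, V + n − 1` is dominated at the extra entries (`domXTall`) -/
def domXTV : ℕ → ℕ → Bool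
  | 0, _ => true
  | n + 1, V => (triplesS V).all (domXTall V (gainOf2371j V)) && domXTV n (V + 1)

/-- the extra entries have parameters `≥ 3` and positive denominators -/
def xdenOK : Bool :=
  (List.range (nl - ix0)).all fun i' => (List.range (nb - jx0)).all fun j' =>
    (xrow (ix0 + i') (jx0 + j')).all fun e => Nat.ble 3 e.1 && Nat.ble 1 e.2.2

/-- Structural facts about the data, all checked by evaluation: every row has `nb` entries; all denominators are positive; the vM fraction is
monotone in the level and in the bucket, the U11-G fraction is monotone in the level; `TB[0] = 1`, `TB` is increasing with `TB[j+1] ≤ 2·TB[j]`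
and (`TB[j] ≤ 1` or `TB[j+1] ≤ TB[j]²`); `TP[j] = TB[j]` or `19 ≤ TP[j]`, and `TP[j] ≤ TB[j]`. -/
def monoOK (nl nb : ℕ) : Bool :=
  Nat.beq (tb 0) 1 &&
  (List.range nl).all (fun i => Nat.beq (E.getD i []).length nb &&
    (List.range nb).all (fun j =>
      Nat.ble 1 (ent i j).2.1 && Nat.ble 1 (ent i j).2.2.2 &&
      (Nat.ble (nl - 1) i || (leP (ent i j) (ent (i + 1) j) && leW (ent i j) (ent (i + 1) j))) &&
      (Nat.ble (nb - 1) j || leP (ent i j) (ent i (j + 1))))) &&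
  (List.range nb).all (fun j => Nat.blt (tb j) (tb (j + 1)) && Nat.ble (tb (j + 1)) (2 * tb j) &&
    (Nat.ble (tb j) 1 || Nat.ble (tb (j + 1)) (tb j * tb j)) &&
    (Nat.beq (tp j) (tb j) || Nat.ble 19 (tp j)) && Nat.ble (tp j) (tb j))

/-! ## The checks (data-free parts reused from `TAStat`) -/

/-- Walk the buckets `j, j+1, …` of a table row (the row dropped to index `j`) for a maximal member (gain `g`, pair-product sum `p`, volume `V`, excess `d`,
smallest size `al`, least pair product `tl`) whose own bucket is `j0`: `TAStatKM.walk5` with this range's data — escape by `tiOK90 V (TB[j])` (valid up to `V < 8100`), else the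
one-member `cover` at `t = TB[j]` or the multi-parameter k-member tree `TAStatKM.coverKX` (complete bucket lists `M2`, full row `rowOf V`, extra entries
`xrowOf V`, at most `kmax` explicit members). -/
def walk (g p V d al tl L H j0 : ℕ) (row : List Entry) (j : ℕ) : Bool :=
  TAStatKM.walk5 tb m2l gainOf2371j (rowOf V) (xrowOf V) tp g p V d al tl kmax L H j0 row j

/-- The check of one sorted candidate shape `x` of volume `V` (gain `g`) as the maximal-volume member, for the orders `max(Lo, V+1) … Hi` (an order sub-range `[Lo, Hi]` of `[lo, Mtop]`; tree-heavy volumes are kernel-checked on several sub-ranges) and all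
buckets from that of `x.1·x.2.1` on (smallest size `x.1`, least pair product `x.1·x.2.1` for the tree's `l`-source test). -/
def checkShape (Lo Hi V g : ℕ) (x : ℕ × ℕ × ℕ) : Bool :=
  Nat.blt Hi (max Lo (V + 1)) ||
    walk g (us x) V (2 * us x - (x.1 + x.2.1 + x.2.2)) x.1 (x.1 * x.2.1) (max Lo (V + 1)) Hi (bucketOf (x.1 * x.2.1))
      ((E.getD (levOf V) []).drop (bucketOf (x.1 * x.2.1))) (bucketOf (x.1 * x.2.1))

/-- every sorted candidate shape of the volumes `V, …, V + n − 1` passes `checkShape` on the orders `[Lo, Hi]` -/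
def checkV (Lo Hi : ℕ) : ℕ → ℕ → Bool
  | 0, _ => true
  | n + 1, V => (triplesS V).all (checkShape Lo Hi V (gainOf2371j V)) && checkV Lo Hi n (V + 1)

/-- completeness of the second-member lists on the volumes `V, …, V + n − 1`: every sorted candidate shape whose bucket is flagged is listed there -/
def m2V : ℕ → ℕ → Bool
  | 0, _ => true
  | n + 1, V => (triplesS V).all (fun x => !(m2f (bucketOf (x.1 * x.2.1))) || (m2l (bucketOf (x.1 * x.2.1))).elem x) && m2V n (V + 1)

/-! ## Specification vocabulary of the soundness proof (checker-internal predicates, no claims) -/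

/-- Sorted candidate shapes: `1 ≤ a ≤ b ≤ c` and the single-member table at order `Mtop`. [bookkeeping] -/
def SCand (x : ℕ × ℕ × ℕ) : Prop :=
  1 ≤ x.1 ∧ x.1 ≤ x.2.1 ∧ x.2.1 ≤ x.2.2 ∧ tableOK Mtop x.1 x.2.1 x.2.2 = true

end Summit.MatrixMultiplication.MatrixMultiplication.Theorems.TAStatE
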